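import Summits.SmoothPoincare4.SmoothPoincare4.Theses.EntropyRung
import Summits.SmoothPoincare4.SmoothPoincare4.Theorems.EntropyRungSubcylindricalExistenceConformalRealisation
import Summits.SmoothPoincare4.SmoothPoincare4.Theorems.EntropyRungSubcylindricalExistenceFlatChartRadial
import Summits.SmoothPoincare4.SmoothPoincare4.Theorems.EntropyRungSubcylindricalExistenceCapFactorRound
import HarnessLib

/-!
# Realising the capped metric `G = Φ² g` inside `M`
(crux stmt-SmoothPoincare4-10871 `EntropyRung.SubcylindricalExistence`, line
`fat-conical-core-avr-logsobolev`, helper stub K2 `helper_capRealisation` of lead c4's skeleton)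

Data: a smooth Riemannian metric `g` (Levi-Civita) on a closed smooth `4`-manifold `M` of the
summit binder, a point `p`, the chart `φ = extChartAt (𝓡 4) p`, `y₀ = φ p`, a radius `r > 0` with
`closedBall y₀ r ⊆ φ.target` on which `φ⁻¹` is a `g`-isometry (flat gauge), a cone factor `Λ`
(smooth and positive off `p`, `Λ ∘ φ⁻¹ = c ‖· − y₀‖^{−(c+1)}` on the punctured closed ball,
`R_g Λ − 6 Δ_g Λ ≥ 0` off `p`) and a capping profile `prof` (smooth, positive on `[0, ∞)`,
`2 prof' + s prof'' ≤ 0` there, `prof'(0) < 0`, and `prof(s) = c s^{−(c+1)/2}` for `s ≥ s_c`,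
`0 < s_c < r²`).

Construction: `Φ x := prof(‖φ x − y₀‖²)` if `x ∈ φ.source` and `‖φ x − y₀‖ < r`, `Φ x := Λ x`
otherwise. On the annulus `s_c ≤ ‖φ x − y₀‖² < r²` the two branches agree
(`c (t²)^{−(c+1)/2} = c t^{−(c+1)}`), so `Φ = Λ` off the compact (hence closed) core
`K = φ⁻¹(closedBall y₀ r ∩ {‖· − y₀‖² ≤ s_c})`, while `K` lies inside the open chart ball where
`Φ = prof(‖· − y₀‖²) ∘ φ`; hence `Φ` is smooth and positive. The conformal metric `G = Φ² g`
(`ConformalRealisation.exists_isRiemannian_conformal_sq`, `PseudoRiemannianMetric.hasLeviCivita`)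
has `R_G = Φ⁻³ (R_g Φ − 6 Δ_g Φ)` (`scalarCurvature_conformal_sq_four`); on the chart ball the
radial calculus of the flat chart (`helper_flatChartRadial`: `R_g = 0`,
`Δ_g Φ = 8 prof' + 4 s prof''`) gives `R_G ∘ φ⁻¹ = −6 prof⁻³ (8 prof' + 4 s prof'') =
−24 prof⁻³ (2 prof' + s prof'') ≥ 0`, positive at `p` (`s = 0`, `prof'(0) < 0`); off `K`,
`Φ = Λ` near the point, so `Δ_g Φ = Δ_g Λ` (locality of `Δ_g`,
`dalembertian_congr_of_eventuallyEq`) and `R_G = Λ⁻³ (R_g Λ − 6 Δ_g Λ) ≥ 0`.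
Everything is proved; no definition, no named fact.

References: T. Aubin, *Nonlinear Analysis on Manifolds* (1982), Ch. 6, §6.3 [Aubin1982];
B. O'Neill, *Semi-Riemannian geometry* (1983), Ch. 3, Def. 3.50 [ONeill1983];
J. M. Lee, T. H. Parker, *The Yamabe problem* (1987), §2 and §6 [LeeParker1987].
-/

noncomputable section

open scoped Manifold ContDiff Topology RealInnerProductSpace
open Set Filter
open Literature.Geometry.Lorentzian Literature.Geometry.Riemannian

-- the registered namespace `Summit.SmoothPoincare4.SmoothPoincare4.Theorems` repeats a component
set_option linter.dupNamespace false

namespace Summit.SmoothPoincare4.SmoothPoincare4.Theorems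

namespace HelperCapRealisationAux

/-- `(t²)^{−(c+1)/2} = t^{−(c+1)}` for `t ≥ 0` (real powers). [folklore] -/
theorem sq_rpow_neg_half {t : ℝ} (ht : 0 ≤ t) (c : ℝ) :
    (t ^ 2) ^ (-(c + 1) / 2) = t ^ (-(c + 1)) := by
  rw [← Real.rpow_two, ← Real.rpow_mul ht]
  congr 1
  ring

section Chart

variable {M : Type*} [TopologicalSpace M] [ChartedSpace (EuclideanSpace ℝ (Fin 4)) M]
  {p : M} {r sc c : ℝ} {Λ Φ : M → ℝ} {prof : ℝ → ℝ}

/-- On the annulus `s_c ≤ ‖φ x − y₀‖² < r²` the profile branch agrees with the cone factor: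
`prof(‖φ x − y₀‖²) = c ‖φ x − y₀‖^{−(c+1)} = Λ x`. [folklore] -/
theorem prof_eq_cone
    (hΛeq : ∀ y ∈ Metric.closedBall (extChartAt (𝓡 4) p p) r, y ≠ extChartAt (𝓡 4) p p →
      Λ ((extChartAt (𝓡 4) p).symm y) = c * ‖y - extChartAt (𝓡 4) p p‖ ^ (-(c + 1)))
    (hcone : ∀ s, sc ≤ s → prof s = c * s ^ (-(c + 1) / 2)) (hsc : 0 < sc) {x : M}
    (hxs : x ∈ (extChartAt (𝓡 4) p).source) (hxr : ‖extChartAt (𝓡 4) p x - extChartAt (𝓡 4) p p‖ < r)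
    (hxc : sc ≤ ‖extChartAt (𝓡 4) p x - extChartAt (𝓡 4) p p‖ ^ 2) :
    prof (‖extChartAt (𝓡 4) p x - extChartAt (𝓡 4) p p‖ ^ 2) = Λ x := by
  have hne : extChartAt (𝓡 4) p x ≠ extChartAt (𝓡 4) p p := fun h ↦ by
    rw [h, sub_self, norm_zero, sq, mul_zero] at hxc
    exact absurd hxc (not_le.mpr hsc)
  have h := hΛeq (extChartAt (𝓡 4) p x) (mem_closedBall_iff_norm.2 hxr.le) hne
  rw [(extChartAt (𝓡 4) p).left_inv hxs] at h
  rw [hcone _ hxc, h, sq_rpow_neg_half (norm_nonneg _)]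

/-- Off the core `K = φ⁻¹(closedBall y₀ r ∩ {‖· − y₀‖² ≤ s_c})` the cap function is the cone
factor. [folklore] -/
theorem eq_cone_of_not_mem_core
    (hΛeq : ∀ y ∈ Metric.closedBall (extChartAt (𝓡 4) p p) r, y ≠ extChartAt (𝓡 4) p p →
      Λ ((extChartAt (𝓡 4) p).symm y) = c * ‖y - extChartAt (𝓡 4) p p‖ ^ (-(c + 1)))
    (hcone : ∀ s, sc ≤ s → prof s = c * s ^ (-(c + 1) / 2)) (hsc : 0 < sc)
    (hΦ₁ : ∀ x ∈ (extChartAt (𝓡 4) p).source, ‖extChartAt (𝓡 4) p x - extChartAt (𝓡 4) p p‖ < r →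
      Φ x = prof (‖extChartAt (𝓡 4) p x - extChartAt (𝓡 4) p p‖ ^ 2))
    (hΦ₂ : ∀ x, ¬ (x ∈ (extChartAt (𝓡 4) p).source ∧
      ‖extChartAt (𝓡 4) p x - extChartAt (𝓡 4) p p‖ < r) → Φ x = Λ x) {x : M}
    (hx : x ∉ (extChartAt (𝓡 4) p).symm ''
      (Metric.closedBall (extChartAt (𝓡 4) p p) r ∩ {y | ‖y - extChartAt (𝓡 4) p p‖ ^ 2 ≤ sc})) :
    Φ x = Λ x := by
  by_cases h : x ∈ (extChartAt (𝓡 4) p).source ∧ ‖extChartAt (𝓡 4) p x - extChartAt (𝓡 4) p p‖ < r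
  · rw [hΦ₁ x h.1 h.2]
    refine prof_eq_cone hΛeq hcone hsc h.1 h.2 (not_lt.mp fun hlt ↦ hx ?_)
    exact ⟨extChartAt (𝓡 4) p x, ⟨mem_closedBall_iff_norm.2 h.2.le, hlt.le⟩,
      (extChartAt (𝓡 4) p).left_inv h.1⟩
  · exact hΦ₂ x h

/-- The core `K` is closed: it is the continuous image under `φ⁻¹` of a compact subset of the
closed chart ball. [folklore] -/
theorem isClosed_core [T2Space M]
    (hT : Metric.closedBall (extChartAt (𝓡 4) p p) r ⊆ (extChartAt (𝓡 4) p).target) :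
    IsClosed ((extChartAt (𝓡 4) p).symm ''
      (Metric.closedBall (extChartAt (𝓡 4) p p) r ∩ {y | ‖y - extChartAt (𝓡 4) p p‖ ^ 2 ≤ sc})) := by
  refine (IsCompact.image_of_continuousOn ((isCompact_closedBall _ _).inter_right
    (isClosed_le (by fun_prop) continuous_const))
    ((continuousOn_extChartAt_symm p).mono (inter_subset_left.trans hT))).isClosed

/-- The core `K` lies in the open chart ball `φ.source ∩ φ⁻¹(ball y₀ r)` (`s_c < r²`).
[folklore] -/
theorem mem_chartBall_of_mem_core
    (hT : Metric.closedBall (extChartAt (𝓡 4) p p) r ⊆ (extChartAt (𝓡 4) p).target)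
    (hr : 0 < r) (hscr : sc < r ^ 2) {x : M}
    (hx : x ∈ (extChartAt (𝓡 4) p).symm ''
      (Metric.closedBall (extChartAt (𝓡 4) p p) r ∩ {y | ‖y - extChartAt (𝓡 4) p p‖ ^ 2 ≤ sc})) :
    x ∈ (extChartAt (𝓡 4) p).source ∧ ‖extChartAt (𝓡 4) p x - extChartAt (𝓡 4) p p‖ < r := by
  obtain ⟨y, ⟨hyr, hys⟩, rfl⟩ := hx
  have hyT := hT hyr
  refine ⟨(extChartAt (𝓡 4) p).map_target hyT, ?_⟩
  rw [(extChartAt (𝓡 4) p).right_inv hyT]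
  exact lt_of_pow_lt_pow_left₀ 2 hr.le (hys.trans_lt hscr)

/-- The pole belongs to the core `K`. [folklore] -/
theorem pole_mem_core (hr : 0 < r) (hsc : 0 < sc) :
    p ∈ (extChartAt (𝓡 4) p).symm ''
      (Metric.closedBall (extChartAt (𝓡 4) p p) r ∩ {y | ‖y - extChartAt (𝓡 4) p p‖ ^ 2 ≤ sc}) :=
  ⟨extChartAt (𝓡 4) p p, ⟨Metric.mem_closedBall_self hr.le, by
    rw [mem_setOf_eq, sub_self, norm_zero, sq, mul_zero]; exact hsc.le⟩, extChartAt_to_inv p⟩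

/-- Off the core, the cap function agrees with the cone factor near the point. [folklore] -/
theorem eventuallyEq_cone [T2Space M]
    (hT : Metric.closedBall (extChartAt (𝓡 4) p p) r ⊆ (extChartAt (𝓡 4) p).target)
    (hΛeq : ∀ y ∈ Metric.closedBall (extChartAt (𝓡 4) p p) r, y ≠ extChartAt (𝓡 4) p p →
      Λ ((extChartAt (𝓡 4) p).symm y) = c * ‖y - extChartAt (𝓡 4) p p‖ ^ (-(c + 1)))
    (hcone : ∀ s, sc ≤ s → prof s = c * s ^ (-(c + 1) / 2)) (hsc : 0 < sc)
    (hΦ₁ : ∀ x ∈ (extChartAt (𝓡 4) p).source, ‖extChartAt (𝓡 4) p x - extChartAt (𝓡 4) p p‖ < r →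
      Φ x = prof (‖extChartAt (𝓡 4) p x - extChartAt (𝓡 4) p p‖ ^ 2))
    (hΦ₂ : ∀ x, ¬ (x ∈ (extChartAt (𝓡 4) p).source ∧
      ‖extChartAt (𝓡 4) p x - extChartAt (𝓡 4) p p‖ < r) → Φ x = Λ x) {x : M}
    (hx : x ∉ (extChartAt (𝓡 4) p).symm ''
      (Metric.closedBall (extChartAt (𝓡 4) p p) r ∩ {y | ‖y - extChartAt (𝓡 4) p p‖ ^ 2 ≤ sc})) :
    Φ =ᶠ[𝓝 x] Λ := by
  filter_upwards [(isClosed_core hT).isOpen_compl.mem_nhds hx] with z hz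
    using eq_cone_of_not_mem_core hΛeq hcone hsc hΦ₁ hΦ₂ hz

/-- On the open chart ball the cap function is the radial profile read through the chart.
[folklore] -/
theorem eventuallyEq_chart
    (hΦ₁ : ∀ x ∈ (extChartAt (𝓡 4) p).source, ‖extChartAt (𝓡 4) p x - extChartAt (𝓡 4) p p‖ < r →
      Φ x = prof (‖extChartAt (𝓡 4) p x - extChartAt (𝓡 4) p p‖ ^ 2)) {x : M}
    (hxs : x ∈ (extChartAt (𝓡 4) p).source) (hxr : ‖extChartAt (𝓡 4) p x - extChartAt (𝓡 4) p p‖ < r) :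
    Φ =ᶠ[𝓝 x] ((fun z : EuclideanSpace ℝ (Fin 4) ↦ prof (‖z - extChartAt (𝓡 4) p p‖ ^ 2)) ∘
      extChartAt (𝓡 4) p) := by
  filter_upwards [(isOpen_extChartAt_preimage' p Metric.isOpen_ball).mem_nhds
    ⟨hxs, mem_ball_iff_norm.2 hxr⟩] with z hz using hΦ₁ z hz.1 (mem_ball_iff_norm.1 hz.2)

/-- **The cap function is smooth**: near the core it is `prof(‖· − y₀‖²) ∘ φ`, off the core it is
the cone factor `Λ`, smooth off the pole. [folklore] -/
theorem contMDiff_cap [T2Space M] [IsManifold (𝓡 4) ∞ M]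
    (hT : Metric.closedBall (extChartAt (𝓡 4) p p) r ⊆ (extChartAt (𝓡 4) p).target)
    (hΛs : ContMDiffOn (𝓡 4) 𝓘(ℝ, ℝ) ∞ Λ {p}ᶜ)
    (hΛeq : ∀ y ∈ Metric.closedBall (extChartAt (𝓡 4) p p) r, y ≠ extChartAt (𝓡 4) p p →
      Λ ((extChartAt (𝓡 4) p).symm y) = c * ‖y - extChartAt (𝓡 4) p p‖ ^ (-(c + 1)))
    (hr : 0 < r) (hprof : ContDiff ℝ ∞ prof) (hsc : 0 < sc) (hscr : sc < r ^ 2)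
    (hcone : ∀ s, sc ≤ s → prof s = c * s ^ (-(c + 1) / 2))
    (hΦ₁ : ∀ x ∈ (extChartAt (𝓡 4) p).source, ‖extChartAt (𝓡 4) p x - extChartAt (𝓡 4) p p‖ < r →
      Φ x = prof (‖extChartAt (𝓡 4) p x - extChartAt (𝓡 4) p p‖ ^ 2))
    (hΦ₂ : ∀ x, ¬ (x ∈ (extChartAt (𝓡 4) p).source ∧
      ‖extChartAt (𝓡 4) p x - extChartAt (𝓡 4) p p‖ < r) → Φ x = Λ x) :
    ContMDiff (𝓡 4) 𝓘(ℝ, ℝ) ∞ Φ := by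
  intro x
  by_cases hx : x ∈ (extChartAt (𝓡 4) p).symm ''
      (Metric.closedBall (extChartAt (𝓡 4) p p) r ∩ {y | ‖y - extChartAt (𝓡 4) p p‖ ^ 2 ≤ sc})
  · obtain ⟨hxs, hxr⟩ := mem_chartBall_of_mem_core hT hr hscr hx
    have hP : ContDiff ℝ ∞ fun z : EuclideanSpace ℝ (Fin 4) ↦
        prof (‖z - extChartAt (𝓡 4) p p‖ ^ 2) :=
      hprof.comp ((contDiff_id.sub contDiff_const).norm_sq ℝ)
    have hxs' : x ∈ (chartAt (EuclideanSpace ℝ (Fin 4)) p).source := by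
      rwa [← extChartAt_source (𝓡 4)]
    exact (hP.contDiffAt.comp_contMDiffAt (contMDiffAt_extChartAt' hxs')).congr_of_eventuallyEq
      (eventuallyEq_chart hΦ₁ hxs hxr)
  · have hxp : x ≠ p := fun h ↦ hx (h ▸ pole_mem_core hr hsc)
    exact (CapFactorRound.contMDiffAt_green hΛs hxp).congr_of_eventuallyEq
      (eventuallyEq_cone hT hΛeq hcone hsc hΦ₁ hΦ₂ hx)

/-- **The cap function is positive** (`prof > 0` on `[0, ∞)`, `Λ > 0` off `p`, and `p` lies in
the chart ball). [folklore] -/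
theorem cap_pos (hΛpos : ∀ x, x ≠ p → 0 < Λ x) (hprofpos : ∀ s, 0 ≤ s → 0 < prof s)
    (hr : 0 < r)
    (hΦ₁ : ∀ x ∈ (extChartAt (𝓡 4) p).source, ‖extChartAt (𝓡 4) p x - extChartAt (𝓡 4) p p‖ < r →
      Φ x = prof (‖extChartAt (𝓡 4) p x - extChartAt (𝓡 4) p p‖ ^ 2))
    (hΦ₂ : ∀ x, ¬ (x ∈ (extChartAt (𝓡 4) p).source ∧
      ‖extChartAt (𝓡 4) p x - extChartAt (𝓡 4) p p‖ < r) → Φ x = Λ x) (x : M) :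
    0 < Φ x := by
  by_cases h : x ∈ (extChartAt (𝓡 4) p).source ∧ ‖extChartAt (𝓡 4) p x - extChartAt (𝓡 4) p p‖ < r
  · rw [hΦ₁ x h.1 h.2]
    exact hprofpos _ (sq_nonneg _)
  · rw [hΦ₂ x h]
    refine hΛpos x fun hxp ↦ h ?_
    subst hxp
    exact ⟨mem_extChartAt_source x, by rwa [sub_self, norm_zero]⟩

/-- **The conformal Laplacian of the cap function off the core** is that of the cone factor
(locality of `Δ_g`, O'Neill 1983, Ch. 3, Def. 3.50). [cite: ONeill1983, Ch. 3, Def. 3.50] -/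
theorem conformalLaplacian_eq_off_core [T2Space M] [IsManifold (𝓡 4) ∞ M]
    (g : PseudoRiemannianMetric (𝓡 4) ∞ (EuclideanSpace ℝ (Fin 4)) (TangentSpace (𝓡 4) : M → Type _))
    [g.HasLeviCivita]
    (hT : Metric.closedBall (extChartAt (𝓡 4) p p) r ⊆ (extChartAt (𝓡 4) p).target)
    (hΛeq : ∀ y ∈ Metric.closedBall (extChartAt (𝓡 4) p p) r, y ≠ extChartAt (𝓡 4) p p →
      Λ ((extChartAt (𝓡 4) p).symm y) = c * ‖y - extChartAt (𝓡 4) p p‖ ^ (-(c + 1)))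
    (hcone : ∀ s, sc ≤ s → prof s = c * s ^ (-(c + 1) / 2)) (hsc : 0 < sc)
    (hΦ₁ : ∀ x ∈ (extChartAt (𝓡 4) p).source, ‖extChartAt (𝓡 4) p x - extChartAt (𝓡 4) p p‖ < r →
      Φ x = prof (‖extChartAt (𝓡 4) p x - extChartAt (𝓡 4) p p‖ ^ 2))
    (hΦ₂ : ∀ x, ¬ (x ∈ (extChartAt (𝓡 4) p).source ∧
      ‖extChartAt (𝓡 4) p x - extChartAt (𝓡 4) p p‖ < r) → Φ x = Λ x) {x : M}
    (hx : x ∉ (extChartAt (𝓡 4) p).symm ''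
      (Metric.closedBall (extChartAt (𝓡 4) p p) r ∩ {y | ‖y - extChartAt (𝓡 4) p p‖ ^ 2 ≤ sc})) :
    g.scalarCurvature x * Φ x - 6 * g.dalembertian Φ x =
      g.scalarCurvature x * Λ x - 6 * g.dalembertian Λ x := by
  have hev := eventuallyEq_cone hT hΛeq hcone hsc hΦ₁ hΦ₂ hx
  rw [g.dalembertian_congr_of_eventuallyEq hev, hev.eq_of_nhds]

end Chart

/-- `−6 P (8 a + 4 s b) ≥ 0` when `P ≥ 0` and `2 a + s b ≤ 0`. [folklore] -/
theorem capCurvature_nonneg {P a b s : ℝ} (hP : 0 ≤ P) (h : 2 * a + s * b ≤ 0) :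
    0 ≤ -6 * P * (8 * a + 4 * s * b) := by
  have key : -6 * P * (8 * a + 4 * s * b) = 24 * P * (-(2 * a + s * b)) := by ring
  rw [key]
  exact mul_nonneg (mul_nonneg (by norm_num) hP) (neg_nonneg.2 h)

end HelperCapRealisationAux

-- the registered signature binds the Riemannian witness as `hG`, which its body does not
-- reference; the unused-variables linter is therefore disabled for this one declaration
set_option linter.unusedVariables false in
/-- **K2 — realising the capped metric `G = Φ² g` inside `M`** (registered helper stub
`helper_capRealisation` of line `fat-conical-core-avr-logsobolev`). For `g` Euclidean in the
chart `φ = extChartAt (𝓡 4) p` on `closedBall (φ p) r`, a cone factor `Λ` of slope `c` there with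
`R_g Λ − 6 Δ_g Λ ≥ 0` off `p`, and a profile `prof` (smooth, positive on `[0, ∞)`,
`2 prof' + s prof'' ≤ 0`, `prof'(0) < 0`, equal to the cone `c s^{−(c+1)/2}` from `s_c < r²` on):
a smooth positive `Φ` with `Φ ∘ φ⁻¹ = prof(‖· − φ p‖²)` on the chart ball and `Φ = Λ` off the
small ball `‖φ x − φ p‖² < s_c`, and the conformal metric `G = Φ² g` with Levi-Civita connection,
`R_G = Φ⁻³ (R_g Φ − 6 Δ_g Φ) ≥ 0`, `R_G(p) > 0`, and on the chart ball
`R_G(φ⁻¹ y) = −6 prof(s)⁻³ (8 prof'(s) + 4 s prof''(s))`, `s = ‖y − φ p‖²`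
(`HelperCapRealisationAux.contMDiff_cap`, `ConformalRealisation.exists_isRiemannian_conformal_sq`,
`scalarCurvature_conformal_sq_four`, `helper_flatChartRadial`,
`HelperCapRealisationAux.conformalLaplacian_eq_off_core`).
[cite: Aubin1982, Ch. 6, §6.3, eq. (1)] -/
theorem helper_capRealisation :
    ∀ (M : Type) [TopologicalSpace M] [T2Space M] [SecondCountableTopology M]
      [ChartedSpace (EuclideanSpace ℝ (Fin 4)) M] [IsManifold (𝓡 4) ∞ M] [CompactSpace M]
      [T3Space M] [MeasurableSpace M] [BorelSpace M]
      (g : PseudoRiemannianMetric (𝓡 4) ∞ (EuclideanSpace ℝ (Fin 4)) (TangentSpace (𝓡 4) : M → Type _))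
      [g.HasLeviCivita] (hg : g.IsRiemannian) (p : M) (r : ℝ) (Λ : M → ℝ) (c : ℝ) (prof : ℝ → ℝ) (sc : ℝ),
      (Metric.closedBall (extChartAt (𝓡 4) p p) r ⊆ (extChartAt (𝓡 4) p).target ∧
        ∀ y ∈ Metric.closedBall (extChartAt (𝓡 4) p p) r, ∀ X W : EuclideanSpace ℝ (Fin 4),
          g.val ((extChartAt (𝓡 4) p).symm y)
            (mfderiv 𝓘(ℝ, EuclideanSpace ℝ (Fin 4)) (𝓡 4) (extChartAt (𝓡 4) p).symm y X)
            (mfderiv 𝓘(ℝ, EuclideanSpace ℝ (Fin 4)) (𝓡 4) (extChartAt (𝓡 4) p).symm y W) = ⟪X, W⟫) →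
      (ContMDiffOn (𝓡 4) 𝓘(ℝ, ℝ) ∞ Λ {p}ᶜ ∧ (∀ x, x ≠ p → 0 < Λ x) ∧
        ∀ y ∈ Metric.closedBall (extChartAt (𝓡 4) p p) r, y ≠ extChartAt (𝓡 4) p p →
          Λ ((extChartAt (𝓡 4) p).symm y) = c * ‖y - extChartAt (𝓡 4) p p‖ ^ (-(c + 1))) →
      0 < r → 0 < c →
      (∀ x, x ≠ p → 0 ≤ g.scalarCurvature x * Λ x - 6 * g.dalembertian Λ x) →
      ContDiff ℝ ∞ prof → (∀ s, 0 ≤ s → 0 < prof s) → 0 < sc → sc < r ^ 2 →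
      (∀ s, sc ≤ s → prof s = c * s ^ (-(c + 1) / 2)) →
      (∀ s, 0 ≤ s → 2 * deriv prof s + s * deriv (deriv prof) s ≤ 0) → deriv prof 0 < 0 →
      ∃ Φ : M → ℝ, ContMDiff (𝓡 4) 𝓘(ℝ, ℝ) ∞ Φ ∧ (∀ x, 0 < Φ x) ∧
        (∀ y ∈ Metric.ball (extChartAt (𝓡 4) p p) r,
          Φ ((extChartAt (𝓡 4) p).symm y) = prof (‖y - extChartAt (𝓡 4) p p‖ ^ 2)) ∧
        (∀ x, Φ x ≠ Λ x →
          x ∈ (extChartAt (𝓡 4) p).source ∧ ‖extChartAt (𝓡 4) p x - extChartAt (𝓡 4) p p‖ ^ 2 < sc) ∧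
        ∃ G : PseudoRiemannianMetric (𝓡 4) ∞ (EuclideanSpace ℝ (Fin 4)) (TangentSpace (𝓡 4) : M → Type _),
        ∃ _ : G.HasLeviCivita, ∃ hG : G.IsRiemannian,
          (∀ (x : M) (v w : TangentSpace (𝓡 4) x), G.val x v w = Φ x ^ 2 * g.val x v w) ∧
          (∀ x, G.scalarCurvature x = (Φ x ^ 3)⁻¹ * (g.scalarCurvature x * Φ x - 6 * g.dalembertian Φ x)) ∧
          (∀ x, 0 ≤ G.scalarCurvature x) ∧ 0 < G.scalarCurvature p ∧
          ∀ y ∈ Metric.ball (extChartAt (𝓡 4) p p) r,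
            G.scalarCurvature ((extChartAt (𝓡 4) p).symm y) =
              -6 * (prof (‖y - extChartAt (𝓡 4) p p‖ ^ 2) ^ 3)⁻¹ *
                (8 * deriv prof (‖y - extChartAt (𝓡 4) p p‖ ^ 2)
                  + 4 * ‖y - extChartAt (𝓡 4) p p‖ ^ 2 * deriv (deriv prof) (‖y - extChartAt (𝓡 4) p p‖ ^ 2)) := by
  classical
  intro M _ _ _ _ _ _ _ _ _ g _ hg p r Λ c prof sc hflat hΛ hr _hc hL hprof hprofpos hsc hscr hcone hR hd0
  obtain ⟨hΛs, hΛpos, hΛeq⟩ := hΛ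
  have hT := hflat.1
  -- the cap function
  set Φ : M → ℝ := fun x ↦
    if x ∈ (extChartAt (𝓡 4) p).source ∧ ‖extChartAt (𝓡 4) p x - extChartAt (𝓡 4) p p‖ < r then
      prof (‖extChartAt (𝓡 4) p x - extChartAt (𝓡 4) p p‖ ^ 2) else Λ x with hΦdef
  have hΦ₁ : ∀ x ∈ (extChartAt (𝓡 4) p).source,
      ‖extChartAt (𝓡 4) p x - extChartAt (𝓡 4) p p‖ < r →
        Φ x = prof (‖extChartAt (𝓡 4) p x - extChartAt (𝓡 4) p p‖ ^ 2) :=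
    fun x hxs hxr ↦ if_pos ⟨hxs, hxr⟩
  have hΦ₂ : ∀ x, ¬ (x ∈ (extChartAt (𝓡 4) p).source ∧
      ‖extChartAt (𝓡 4) p x - extChartAt (𝓡 4) p p‖ < r) → Φ x = Λ x := fun x h ↦ if_neg h
  have hΦs : ContMDiff (𝓡 4) 𝓘(ℝ, ℝ) ∞ Φ :=
    HelperCapRealisationAux.contMDiff_cap hT hΛs hΛeq hr hprof hsc hscr hcone hΦ₁ hΦ₂
  have hΦpos : ∀ x, 0 < Φ x := HelperCapRealisationAux.cap_pos hΛpos hprofpos hr hΦ₁ hΦ₂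
  -- (a) the chart representative on the open ball
  have ha : ∀ y ∈ Metric.ball (extChartAt (𝓡 4) p p) r,
      Φ ((extChartAt (𝓡 4) p).symm y) = prof (‖y - extChartAt (𝓡 4) p p‖ ^ 2) := fun y hy ↦ by
    have hyT := hT (Metric.ball_subset_closedBall hy)
    have h := hΦ₁ ((extChartAt (𝓡 4) p).symm y) ((extChartAt (𝓡 4) p).map_target hyT)
    rw [(extChartAt (𝓡 4) p).right_inv hyT] at h
    exact h (mem_ball_iff_norm.1 hy)
  -- (b) `Φ = Λ` off the small ball
  have hb : ∀ x, Φ x ≠ Λ x → x ∈ (extChartAt (𝓡 4) p).source ∧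
      ‖extChartAt (𝓡 4) p x - extChartAt (𝓡 4) p p‖ ^ 2 < sc := fun x hx ↦ by
    by_contra hcon
    by_cases h : x ∈ (extChartAt (𝓡 4) p).source ∧
        ‖extChartAt (𝓡 4) p x - extChartAt (𝓡 4) p p‖ < r
    · exact hx ((hΦ₁ x h.1 h.2).trans (HelperCapRealisationAux.prof_eq_cone hΛeq hcone hsc h.1 h.2
        (not_lt.mp fun hlt ↦ hcon ⟨h.1, hlt⟩)))
    · exact hx (hΦ₂ x h)
  -- the conformal metric `G = Φ² g` and its scalar curvature
  obtain ⟨G, hG, hval⟩ := ConformalRealisation.exists_isRiemannian_conformal_sq g hg hΦs hΦpos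
  haveI hLC : G.HasLeviCivita := G.hasLeviCivita
  have hE : Module.finrank ℝ (EuclideanSpace ℝ (Fin 4)) = 4 := finrank_euclideanSpace_fin
  have hRG : ∀ x, G.scalarCurvature x =
      (Φ x ^ 3)⁻¹ * (g.scalarCurvature x * Φ x - 6 * g.dalembertian Φ x) :=
    PseudoRiemannianMetric.scalarCurvature_conformal_sq_four hE g G hΦs hΦpos hval
  -- (f) the chart formula, from the radial calculus in the flat chart
  have hrad := helper_flatChartRadial M g p r Φ prof hr hflat hprof ha
  have hf : ∀ y ∈ Metric.ball (extChartAt (𝓡 4) p p) r,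
      G.scalarCurvature ((extChartAt (𝓡 4) p).symm y) =
        -6 * (prof (‖y - extChartAt (𝓡 4) p p‖ ^ 2) ^ 3)⁻¹ *
          (8 * deriv prof (‖y - extChartAt (𝓡 4) p p‖ ^ 2)
            + 4 * ‖y - extChartAt (𝓡 4) p p‖ ^ 2 *
              deriv (deriv prof) (‖y - extChartAt (𝓡 4) p p‖ ^ 2)) := fun y hy ↦ by
    obtain ⟨hR0, -, hΔ⟩ := hrad y hy
    rw [hRG, hR0, hΔ, ha y hy]
    ring
  -- (d) `R_G ≥ 0`
  have hd : ∀ x, 0 ≤ G.scalarCurvature x := fun x ↦ by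
    by_cases hx : x ∈ (extChartAt (𝓡 4) p).symm ''
        (Metric.closedBall (extChartAt (𝓡 4) p p) r ∩ {y | ‖y - extChartAt (𝓡 4) p p‖ ^ 2 ≤ sc})
    · obtain ⟨hxs, hxr⟩ := HelperCapRealisationAux.mem_chartBall_of_mem_core hT hr hscr hx
      have h := hf (extChartAt (𝓡 4) p x) (mem_ball_iff_norm.2 hxr)
      rw [(extChartAt (𝓡 4) p).left_inv hxs] at h
      rw [h]
      exact HelperCapRealisationAux.capCurvature_nonneg
        (inv_nonneg.2 (pow_nonneg (hprofpos _ (sq_nonneg _)).le 3)) (hR _ (sq_nonneg _))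
    · have hxp : x ≠ p := fun h ↦ hx (h ▸ HelperCapRealisationAux.pole_mem_core hr hsc)
      rw [hRG x, HelperCapRealisationAux.conformalLaplacian_eq_off_core g hT hΛeq hcone hsc hΦ₁ hΦ₂ hx]
      exact mul_nonneg (inv_nonneg.2 (pow_nonneg (hΦpos x).le 3)) (hL x hxp)
  -- (e) `R_G(p) > 0`
  have he : 0 < G.scalarCurvature p := by
    have h := hf (extChartAt (𝓡 4) p p) (Metric.mem_ball_self hr)
    rw [extChartAt_to_inv, sub_self, norm_zero, sq, mul_zero] at h
    rw [h]
    have key : -6 * (prof 0 ^ 3)⁻¹ * (8 * deriv prof 0 + 4 * 0 * deriv (deriv prof) 0) =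
        48 * (prof 0 ^ 3)⁻¹ * (-deriv prof 0) := by ring
    rw [key]
    exact mul_pos (mul_pos (by norm_num) (inv_pos.2 (pow_pos (hprofpos 0 le_rfl) 3)))
      (neg_pos.2 hd0)
  exact ⟨Φ, hΦs, hΦpos, ha, hb, G, hLC, hG, hval, hRG, hd, he, hf⟩

end Summit.SmoothPoincare4.SmoothPoincare4.Theorems

end
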